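import Literature.Computability.QuantumComplexity.SLPCodesTrunc
import Literature.Computability.QuantumComplexity.GRLevelWord
import HarnessLib

/-!
# The Grover–Rudolph level program as a truncated-affine parametric program; its compiler output in polynomial time

Topic `Literature/Computability/QuantumComplexity`; the S3 compiler input of the UNIFORMITY of Regev's sampler
([Regev2009, Lemma 3.14, proof]; [GroverRudolph2002, eq. (5)]). The classical straight-line program of every gadget of the
Grover–Rudolph stage is `GRWord.prog k = SLP.grLevelB k 0` (`GRLevelWord.lean`, `GRPredicates.lean`), independent of the
level; its leaves are truncated-affine in the precision `k` (`2^{k−1}`, `2^{2(k−1)}` in `SLP.sOffB`). We write its mirror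
`grLevelPB3 o : AJLCore.PB3` (`SLPCodesTrunc.lean`), prove `(grLevelPB3 o).inst k = SLP.grLevelB k o`, and conclude that the
compiler output `(GRWord.prog k).compile (SLP.thrWd k) 0 0` — the input of the layout abstraction `GP.gopsA` / of the kit
sizes `GenKit.gR/gF/gT` (`GenKitAbstract.lean`, `GenKit.lean`) — is computed in polynomial time from `1ᵏ`
(`AJLCore.compile_inst_codeFP3`; Arora–Barak §6.2, proof of Thm. 6.15):

* mirrors `AJLCore.itePB3`, `bitPB3`, `truePB3`, `thr0PB3`, `rotSignPB3`, `aPA3`, `fldPA3`, `ltFieldPB3`, `sOffPB3`,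
  **`grLevelPB3`** with `inst_*` lemmas, **`AJLCore.inst_grLevelPB3 : (grLevelPB3 o).inst k = SLP.grLevelB k o`**;
* **`GRWord.prog_compile_codeFP : CodeFP unE AJLCore.outBE (fun k => (GRWord.prog k).compile (SLP.thrWd k) 0 0)`**.

Everything is proved; no named fact is introduced.

## References

* O. Regev, J. ACM 56(6) (2009), Lemma 3.12, Lemma 3.14 (proof) [Regev2009].
* L. Grover, T. Rudolph, arXiv:quant-ph/0208112 (2002), eq. (5) [GroverRudolph2002].
* S. Arora, B. Barak, *Computational Complexity: A Modern Approach*, CUP 2009, §1.3, §6.2 [AroraBarak2009].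
-/

noncomputable section

namespace Literature.Computability.QuantumComplexity

open _root_.Computability Complexity Complexity.CodeFP SLP

namespace AJLCore

section Mirrors3

/-- `if c then x else y`. [folklore] -/
def itePB3 (c x y : PB3) : PB3 := .or (.and c x) (.and (.not c) y)
/-- the bit at a truncated-affine offset. [folklore] -/
def bitPB3 (off : Aff3) : PB3 := .lt (PA.toPA3 zeroPA) (.fld off (0, 1, 0))
/-- `true` at a truncated-affine offset. [folklore] -/
def truePB3 (f : Aff3) : PB3 := .or (bitPB3 f) (.not (bitPB3 f))
/-- `T₀`. [folklore] -/
def thr0PB3 : PB3 := thr0PB.toPB3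
/-- the averaging field `a`. [folklore] -/
def aPA3 : PA3 := aPA.toPA3
/-- the rotation sign predicate. [folklore] -/
def rotSignPB3 (ctl pd p10 p01 : PB3) : PB3 :=
  itePB3 ctl (itePB3 (bitPB3 (1, 0, 0)) (itePB3 (bitPB3 (1, 1, 0)) p01 p10) pd) (itePB3 (bitPB3 (1, 0, 0)) thr0PB3 (truePB3 (1, 0, 0)))
/-- the field `F` at offset `k + 2 + o`, `k` bits. [folklore] -/
def fldPA3 (o : ℕ) : PA3 := .fld (1, 2 + o, 0) (1, 0, 0)
/-- `n < F`. [folklore] -/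
def ltFieldPB3 (o : ℕ) : PB3 := .lt aPA3 (fldPA3 o)
/-- the off-diagonal predicate `sOffB`. [cite: GroverRudolph2002, eq. (5)] -/
def sOffPB3 (o : ℕ) : PB3 :=
  .and (.lt aPA3 (.add (.pw (1, 0, 1)) (.pw (0, 0, 0)) (0, 0, 0)))
    (.lt (.add (.add (PA.toPA3 zeroPA) aPA3 (1, 0, 0)) (fldPA3 o) (1, 0, 0))
      (.add (.add (.mul aPA3 aPA3) (.mul (fldPA3 o) (fldPA3 o)) (0, 0, 0)) (.pw (2, 0, 2)) (0, 0, 0)))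
/-- **The parametric Grover–Rudolph level program.** [cite: GroverRudolph2002, eq. (5)] [cite: Regev2009, Lemma 3.12 (proof)] -/
def grLevelPB3 (o : ℕ) : PB3 := rotSignPB3 (truePB3 (1, 2, 0)) (.not (ltFieldPB3 o)) (.not (sOffPB3 o)) (sOffPB3 o)

variable (k : ℕ)

/-- Values of truncated-affine leaves. [folklore] -/
theorem Aff3.ev_mk (a b c : ℕ) : Aff3.ev (a, b, c) k = a * k + b - c := rfl

attribute [local simp] PA3.inst PB3.inst Aff3.ev_mk Nat.zero_mul Nat.one_mul Nat.zero_add Nat.add_zero Nat.sub_zero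

/-- [folklore] -/ @[simp] theorem inst_toPA3_zeroPA : (PA.toPA3 zeroPA).inst k = zeroE := by rw [PA.inst_toPA3, inst_zeroPA]
/-- [folklore] -/ @[simp] theorem inst_aPA3 : aPA3.inst k = aE k := by rw [aPA3, PA.inst_toPA3, inst_aPA]
/-- [folklore] -/ @[simp] theorem inst_bitPB3 (f : Aff3) : (bitPB3 f).inst k = bitB (f.ev k) := by simp [bitPB3, bitB]
/-- [folklore] -/ @[simp] theorem inst_truePB3 (f : Aff3) : (truePB3 f).inst k = trueB (f.ev k) := by simp [truePB3, trueB]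
/-- [folklore] -/ @[simp] theorem inst_thr0PB3 : thr0PB3.inst k = thr0B k := by rw [thr0PB3, PB.inst_toPB3, inst_thr0PB]
/-- [folklore] -/ @[simp] theorem inst_itePB3 (c x y : PB3) : (itePB3 c x y).inst k = iteB (c.inst k) (x.inst k) (y.inst k) := by
  simp [itePB3, iteB]
/-- [folklore] -/ @[simp] theorem inst_rotSignPB3 (ctl pd p10 p01 : PB3) :
    (rotSignPB3 ctl pd p10 p01).inst k = rotSignB k (ctl.inst k) (pd.inst k) (p10.inst k) (p01.inst k) := by simp [rotSignPB3, rotSignB]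
/-- [folklore] -/ @[simp] theorem inst_fldPA3 (o : ℕ) : (fldPA3 o).inst k = .fld (k + 2 + o) k := by
  simp [fldPA3]; omega
/-- [folklore] -/ @[simp] theorem inst_ltFieldPB3 (o : ℕ) : (ltFieldPB3 o).inst k = ltFieldB k o := by simp [ltFieldPB3, ltFieldB]
/-- [cite: GroverRudolph2002, eq. (5)] -/ @[simp] theorem inst_sOffPB3 (o : ℕ) : (sOffPB3 o).inst k = sOffB k o := by
  simp [sOffPB3, sOffB, shlE]; omega
/-- **The parametric level program is the level program.** [cite: GroverRudolph2002, eq. (5)] [cite: Regev2009, Lemma 3.12 (proof)] -/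
@[simp] theorem inst_grLevelPB3 (o : ℕ) : (grLevelPB3 o).inst k = grLevelB k o := by
  simp [grLevelPB3, grLevelB]

end Mirrors3

end AJLCore

/-- **The compiler output of the Grover–Rudolph level program from `1ᵏ` in polynomial time.**
[cite: Regev2009, Lemma 3.14 (proof)] [cite: AroraBarak2009, §6.2 (proof of Thm. 6.15)] -/
theorem GRWord.prog_compile_codeFP : CodeFP unE AJLCore.outBE (fun k => (GRWord.prog k).compile (SLP.thrWd k) 0 0) :=
  (AJLCore.compile_inst_codeFP3 (AJLCore.grLevelPB3 0)).congr fun k => by rw [AJLCore.inst_grLevelPB3]; rfl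

end Literature.Computability.QuantumComplexity

end
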